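import Summits.QuantumFields.GaugeBoot.TiltedLatticeHaarShift
import Literature.MathematicalPhysics.QuantumLattice.TorusWilsonGibbs
import Literature.MathematicalPhysics.QuantumFieldTheory.StrongCouplingActivities
import HarnessLib

/-!
# In finite volume the Haar-shift identities (measure-form loop equations) have exactly ONE solution: the Wilson measure, at every coupling (gauge-boot, L1 supplement)

HONEST FRAMING (cell `pub-gaugeboot`, page 1 of every file): the venture produces certified bounds
on lattice expectations at stated coupling, gauge group, dimension and torus size; NOT a mass gap,
NOT a continuum limit, NOT a string tension; NOT Yang–Mills-summit-bearing (barriers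
`FixedCouplingUltralocality`, `PerturbativeInvisibility`). This module is a structural statement
about finite periodic lattices; it certifies no number.

## Content

The lattice bootstrap starts from the loop (Schwinger–Dyson) equations of the finite-volume
Wilson measure, whose measure form is the one-link Haar-shift identity
(`TiltedLatticeHaarShift.integral_comp_update_mul_gibbs`, `haarShift_wilsonExpectation`):
`∫ f(U[l ↦ g U_l]) dμ = ∫ f(U) e^{-β (S(U[l ↦ g⁻¹ U_l]) - S(U))} dμ`. This file proves the CONVERSE
in finite volume, for EVERY real `β` (no strong-coupling hypothesis):

* ★★ `eq_pi_tilted_of_haarShift` — abstract form: on the compact metrisable group `ι → G`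
  (`ι` finite), a probability measure satisfying the Haar-shift identities of a continuous energy
  `ψ` for every coordinate `i`, every `g ∈ G` and every continuous test function IS the Gibbs
  reweighting `(Haar^{⊗ι}).tilted ψ`. Proof: the tilt `e^{-ψ} dμ / Z` is invariant under every
  one-coordinate left shift (bounded continuous functions separate finite Borel measures), hence
  under left multiplication by every element of the product group (a product of finitely many
  coordinate shifts, `map_mulShiftOn_tilted`), hence is THE Haar probability measure
  (`haarMeasure_eq_iff`) — which is also the product of the Haar measures; undo the tilt.
* ★★★ `TiltedRP.eq_gibbs_of_haarShift` / `TiltedRP.eq_gibbs_iff_haarShift` — on every finite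
  periodic lattice of `TiltedLatticeGauge.lean` (cubic tori, 45°-tilted boxes, …) a probability
  measure obeys the one-link Haar-shift identities of the Wilson action at `β` for all links iff it
  IS the Wilson measure `gibbs ρ e β`;
* ★★★ `eq_wilsonMeasure_of_haarShift` — the same for Wave 0's torus Wilson measure
  `wilsonMeasure ρ β` on `(ℤ/L)^d` (`wilsonMeasure_eq_tilted_pi`).

So in finite volume "the loop equations in measure form + realisability by a probability measure"
determine every Wilson-loop expectation exactly, at every `β`; the infinite-volume analogue holds at
strong coupling only (`HaarShiftUniqueness.lean`: the Haar-shift states of `ℤ^d` are the DLR states,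
unique for `6(d-1) N |β| < 1`, in general not unique).

References: A. Weil / Haar uniqueness (Mathlib `MeasureTheory.Measure.haarMeasure_eq_iff`);
V. Kazakov, Z. Zheng, arXiv:2203.11360 §2; P. Anderson, M. Kruczenski, Nucl. Phys. B 921 (2017)
§2 (loop equations and positivity); S. Cao, M. Park, S. Sheffield, Comm. AMS 5 (2025) Thm. 5.7.
Folklore; no printed statement of the measure-form uniqueness was found.
-/

noncomputable section

open MeasureTheory
open Literature.MathematicalPhysics.QuantumFieldTheory (haarProbability)

namespace Summit.QuantumFields.GaugeBoot

/-! ## Abstract form: a finite product of copies of a compact group -/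

section Abstract

variable {ι : Type*} [Fintype ι] [DecidableEq ι] {G : Type*} [Group G] [TopologicalSpace G]
  [IsTopologicalGroup G] [CompactSpace G] [MeasurableSpace G] [BorelSpace G] [T2Space G]
  [SecondCountableTopology G]

omit [Fintype ι] [TopologicalSpace G] [IsTopologicalGroup G] [CompactSpace G] [MeasurableSpace G]
  [BorelSpace G] [T2Space G] [SecondCountableTopology G] in
/-- Adding a coordinate to the shifted set is one more one-coordinate shift. -/
theorem mulShiftOn_insert {s : Finset ι} {i : ι} (hi : i ∉ s) (h U : ι → G) :
    (fun j => if j ∈ insert i s then h j * U j else U j) =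
      Function.update (fun j => if j ∈ s then h j * U j else U j) i
        (h i * (fun j => if j ∈ s then h j * U j else U j) i) := by
  funext j
  by_cases hj : j = i
  · subst hj
    simp [hi]
  · rw [Function.update_of_ne hj]
    simp [Finset.mem_insert, hj]

omit [Fintype ι] [TopologicalSpace G] [IsTopologicalGroup G] [CompactSpace G] [BorelSpace G]
  [T2Space G] [SecondCountableTopology G] in
/-- The partial shifts are measurable. -/
theorem measurable_mulShiftOn [MeasurableMul G] (s : Finset ι) (h : ι → G) :
    Measurable fun U : ι → G => fun j => if j ∈ s then h j * U j else U j := by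
  refine measurable_pi_iff.2 fun j => ?_
  by_cases hj : j ∈ s
  · simp only [hj, if_true]
    exact (measurable_pi_apply j).const_mul _
  · simp only [hj, if_false]
    exact measurable_pi_apply j

omit [Fintype ι] [TopologicalSpace G] [IsTopologicalGroup G] [CompactSpace G] [BorelSpace G]
  [T2Space G] [SecondCountableTopology G] in
/-- **One-coordinate shift invariance implies invariance under all partial shifts** (induction on
the finite set of shifted coordinates). -/
theorem map_mulShiftOn_eq [MeasurableMul G] {ν : Measure (ι → G)}
    (hν : ∀ (i : ι) (g : G), ν.map (fun U => Function.update U i (g * U i)) = ν)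
    (h : ι → G) (s : Finset ι) :
    ν.map (fun U : ι → G => fun j => if j ∈ s then h j * U j else U j) = ν := by
  induction s using Finset.induction_on with
  | empty => simp
  | insert i s hi ih =>
    have hcomp : (fun U : ι → G => fun j => if j ∈ insert i s then h j * U j else U j) =
        (fun U => Function.update U i (h i * U i)) ∘
          fun U : ι → G => fun j => if j ∈ s then h j * U j else U j := by
      funext U
      exact mulShiftOn_insert hi h U
    have hmi : Measurable fun U : ι → G => Function.update U i (h i * U i) :=
      measurable_pi_iff.2 fun j => by
        by_cases hj : j = i
        · subst hj
          simp only [Function.update_self]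
          exact (measurable_pi_apply j).const_mul _
        · simp only [Function.update_of_ne hj]
          exact measurable_pi_apply j
    rw [hcomp, ← Measure.map_map hmi (measurable_mulShiftOn s h), ih, hν i (h i)]

omit [TopologicalSpace G] [IsTopologicalGroup G] [CompactSpace G] [BorelSpace G] [T2Space G]
  [SecondCountableTopology G] in
/-- **One-coordinate shift invariance implies left invariance under the product group.** -/
theorem isMulLeftInvariant_of_forall_map_update [MeasurableMul G] {ν : Measure (ι → G)}
    (hν : ∀ (i : ι) (g : G), ν.map (fun U => Function.update U i (g * U i)) = ν) :
    ν.IsMulLeftInvariant := by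
  refine ⟨fun h => ?_⟩
  have key := map_mulShiftOn_eq hν h Finset.univ
  have hfun : (fun U : ι → G => fun j => if j ∈ (Finset.univ : Finset ι) then h j * U j else U j) =
      fun U => h * U := by
    funext U j
    simp [Pi.mul_apply]
  rwa [hfun] at key

omit [DecidableEq ι] [T2Space G] in
/-- **On a compact metrisable product group a left-invariant probability measure is the product of
the Haar probability measures** (Haar uniqueness, Mathlib `haarMeasure_eq_iff`, applied twice). -/
theorem eq_pi_haar_of_isMulLeftInvariant [Nonempty G] (ν : Measure (ι → G)) [IsProbabilityMeasure ν]
    [ν.IsMulLeftInvariant] : ν = Measure.pi fun _ : ι => haarProbability G := by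
  have h1 : Measure.haarMeasure (⊤ : TopologicalSpace.PositiveCompacts (ι → G)) = ν :=
    (Measure.haarMeasure_eq_iff ⊤ ν).2 (by
      rw [TopologicalSpace.PositiveCompacts.coe_top, measure_univ])
  have h2 : Measure.haarMeasure (⊤ : TopologicalSpace.PositiveCompacts (ι → G)) =
      Measure.pi fun _ : ι => haarProbability G :=
    (Measure.haarMeasure_eq_iff ⊤ _).2 (by
      rw [TopologicalSpace.PositiveCompacts.coe_top, measure_univ])
  rw [← h1, h2]

/-- ★★ **The Haar-shift identities characterise the Gibbs reweightings of product Haar measure**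
(finite product of a compact metrisable group, EVERY continuous energy `ψ`): if a probability
measure `μ` on `ι → G` satisfies, for every coordinate `i`, every `g ∈ G` and every continuous `f`,
`∫ f(U[i ↦ g U_i]) dμ = ∫ f(U) e^{ψ(U[i ↦ g⁻¹ U_i]) - ψ(U)} dμ`, then
`μ = (Haar^{⊗ι}).tilted ψ = e^{ψ} dU / Z`. [folklore] -/
theorem eq_pi_tilted_of_haarShift [Nonempty G] {ψ : (ι → G) → ℝ} (hψ : Continuous ψ)
    {μ : Measure (ι → G)} [IsProbabilityMeasure μ]
    (h : ∀ (i : ι) (g : G) (f : (ι → G) → ℝ), Continuous f →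
      ∫ U, f (Function.update U i (g * U i)) ∂μ =
        ∫ U, f U * Real.exp (ψ (Function.update U i (g⁻¹ * U i)) - ψ U) ∂μ) :
    μ = (Measure.pi fun _ : ι => haarProbability G).tilted ψ := by
  -- the tilt `ν = e^{-ψ} dμ / Z`
  have hw : Continuous fun U : ι → G => Real.exp (-ψ U) := Real.continuous_exp.comp hψ.neg
  obtain ⟨C, hC⟩ : ∃ C, ∀ U : ι → G, ‖Real.exp (-ψ U)‖ ≤ C := by
    obtain ⟨C, hC⟩ := isCompact_univ.exists_bound_of_continuousOn hw.continuousOn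
    exact ⟨C, fun U => hC U (Set.mem_univ U)⟩
  have hint : Integrable (fun U : ι → G => Real.exp (-ψ U)) μ :=
    Integrable.of_bound hw.aestronglyMeasurable C (ae_of_all _ hC)
  haveI hνprob : IsProbabilityMeasure (μ.tilted fun U => -ψ U) := isProbabilityMeasure_tilted hint
  -- one-coordinate shift invariance of the tilt
  have hshift : ∀ (i : ι) (g : G),
      (μ.tilted fun U => -ψ U).map (fun U => Function.update U i (g * U i)) =
        μ.tilted fun U => -ψ U := by
    intro i g
    have hτc : Continuous fun U : ι → G => Function.update U i (g * U i) :=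
      continuous_pi fun j => by
        by_cases hj : j = i
        · subst hj
          simp only [Function.update_self]
          exact continuous_const.mul (continuous_apply j)
        · simp only [Function.update_of_ne hj]
          exact continuous_apply j
    have hτ : Measurable fun U : ι → G => Function.update U i (g * U i) := hτc.measurable
    haveI : IsProbabilityMeasure ((μ.tilted fun U => -ψ U).map
        fun U => Function.update U i (g * U i)) := Measure.isProbabilityMeasure_map hτ.aemeasurable
    refine ext_of_forall_integral_eq_of_IsFiniteMeasure fun F => ?_
    rw [integral_map hτ.aemeasurable F.continuous.aestronglyMeasurable, integral_tilted,
      integral_tilted]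
    simp only [smul_eq_mul]
    -- the Haar-shift identity for `F · (e^{-ψ} ∘ shift by g⁻¹)`
    have key := h i g (fun U => F U * Real.exp (-ψ (Function.update U i (g⁻¹ * U i))))
      (F.continuous.mul (Real.continuous_exp.comp (hψ.comp (continuous_pi fun j => by
        by_cases hj : j = i
        · subst hj
          simp only [Function.update_self]
          exact continuous_const.mul (continuous_apply j)
        · simp only [Function.update_of_ne hj]
          exact continuous_apply j)).neg))
    have h1 : ∀ U : ι → G, F (Function.update U i (g * U i)) * Real.exp (-ψ (Function.update
        (Function.update U i (g * U i)) i (g⁻¹ * Function.update U i (g * U i) i))) =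
        F (Function.update U i (g * U i)) * Real.exp (-ψ U) := fun U => by
      rw [Function.update_self, inv_mul_cancel_left, Function.update_idem, Function.update_eq_self]
    have h2 : ∀ U : ι → G, F U * Real.exp (-ψ (Function.update U i (g⁻¹ * U i))) *
        Real.exp (ψ (Function.update U i (g⁻¹ * U i)) - ψ U) = F U * Real.exp (-ψ U) := fun U => by
      rw [mul_assoc, ← Real.exp_add]
      congr 2
      ring
    simp only [h1, h2] at key
    have hL : ∀ U : ι → G, Real.exp (-ψ U) / (∫ V, Real.exp (-ψ V) ∂μ) *
        F (Function.update U i (g * U i)) =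
        (∫ V, Real.exp (-ψ V) ∂μ)⁻¹ * (F (Function.update U i (g * U i)) * Real.exp (-ψ U)) :=
      fun U => by rw [div_eq_mul_inv]; ring
    have hR : ∀ U : ι → G, Real.exp (-ψ U) / (∫ V, Real.exp (-ψ V) ∂μ) * F U =
        (∫ V, Real.exp (-ψ V) ∂μ)⁻¹ * (F U * Real.exp (-ψ U)) := fun U => by
      rw [div_eq_mul_inv]; ring
    simp_rw [hL, hR]
    rw [integral_const_mul, integral_const_mul, key]
  -- hence the tilt is THE Haar probability measure = product Haar
  haveI := isMulLeftInvariant_of_forall_map_update hshift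
  have hν : (μ.tilted fun U => -ψ U) = Measure.pi fun _ : ι => haarProbability G :=
    eq_pi_haar_of_isMulLeftInvariant _
  -- undo the tilt
  have hback : (μ.tilted fun U => -ψ U).tilted ψ = μ := by
    rw [tilted_tilted hint]
    have h0 : ((fun U : ι → G => -ψ U) + ψ) = 0 := by
      funext U; simp
    rw [h0, tilted_zero]
  rw [← hback, hν]

end Abstract

/-! ## Finite periodic lattices and the cubic torus -/

namespace TiltedRP

variable {A : Type*} [AddCommGroup A] [Fintype A] [DecidableEq A] {d N : ℕ} {G : Type*} [Group G]
  [TopologicalSpace G] [IsTopologicalGroup G] [CompactSpace G] [MeasurableSpace G] [BorelSpace G]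
  [T2Space G] [SecondCountableTopology G] (ρ : G →* Matrix (Fin N) (Fin N) ℂ)

/-- ★★★ **On a finite periodic lattice the one-link Haar-shift identities determine the Wilson
measure, at EVERY coupling.** For the periodic lattice `(A, e)` of `TiltedLatticeGauge.lean`
(finite site group `A`, marked translations `e`; cubic tori and 45°-tilted boxes are instances),
`G` compact metrisable, `ρ` continuous and any real `β`: a probability measure `μ` on
`Config A d G` with `∫ f(U[l ↦ g U_l]) dμ = ∫ f(U) e^{-β (S(U[l ↦ g⁻¹ U_l]) - S(U))} dμ` for every
link `l`, every `g ∈ G` and every continuous `f` IS the Wilson measure `gibbs ρ e β` — the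
measure-form loop equations have a unique realisable solution in finite volume. [folklore] -/
theorem eq_gibbs_of_haarShift [Nonempty G] (hρ : Continuous ρ) (e : Fin d → A) (β : ℝ)
    {μ : Measure (Config A d G)} [IsProbabilityMeasure μ]
    (h : ∀ (l : Link A d) (g : G) (f : Config A d G → ℝ), Continuous f →
      ∫ U, f (Function.update U l (g * U l)) ∂μ =
        ∫ U, f U * Real.exp (-(β * (wilsonAction ρ e (Function.update U l (g⁻¹ * U l)) -
          wilsonAction ρ e U))) ∂μ) :
    μ = gibbs ρ e β := by
  have hψ : Continuous fun U : Config A d G => -β * wilsonAction ρ e U :=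
    continuous_const.mul (continuous_wilsonAction ρ hρ e)
  have hμ := eq_pi_tilted_of_haarShift (ι := Link A d) (G := G) hψ (μ := μ) fun l g f hf => by
    rw [h l g f hf]
    refine integral_congr_ae (ae_of_all _ fun U => ?_)
    simp only [show ∀ a b : ℝ, -(β * (a - b)) = -β * a - -β * b from fun a b => by ring]
  rw [hμ]
  rfl

/-- ★★★ **The finite-volume loop-equation state is unique**: a probability measure on the
configurations of a finite periodic lattice satisfies the one-link Haar-shift identities of the
Wilson action at `β` (for continuous test functions) iff it is the Wilson measure `gibbs ρ e β`
(`⇐`: `integral_comp_update_mul_gibbs`). [folklore] -/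
theorem eq_gibbs_iff_haarShift [Nonempty G] (hρ : Continuous ρ) (e : Fin d → A) (β : ℝ)
    {μ : Measure (Config A d G)} [IsProbabilityMeasure μ] :
    μ = gibbs ρ e β ↔
      ∀ (l : Link A d) (g : G) (f : Config A d G → ℝ), Continuous f →
        ∫ U, f (Function.update U l (g * U l)) ∂μ =
          ∫ U, f U * Real.exp (-(β * (wilsonAction ρ e (Function.update U l (g⁻¹ * U l)) -
            wilsonAction ρ e U))) ∂μ := by
  refine ⟨fun hμ l g f _ => ?_, eq_gibbs_of_haarShift ρ hρ e β⟩
  rw [hμ]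
  exact integral_comp_update_mul_gibbs ρ e β l g f

end TiltedRP

/-! ## The cubic torus of Wave 0 -/

section Torus

open Literature.MathematicalPhysics.QuantumFieldTheory (Edge GaugeConfig wilsonAction wilsonMeasure
  plaquetteHolonomy)
open Literature.MathematicalPhysics.QuantumLattice (wilsonMeasure_eq_tilted_pi)

variable {d L N : ℕ} {G : Type*} [Group G] [TopologicalSpace G] [IsTopologicalGroup G]
  [CompactSpace G] [MeasurableSpace G] [BorelSpace G] [T2Space G] [SecondCountableTopology G]
  (ρ : G →* Matrix (Fin N) (Fin N) ℂ)

/-- ★★★ **On the torus `(ℤ/L)^d` the one-link Haar-shift identities determine Wilson's measure, at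
EVERY coupling**: a probability measure on `GaugeConfig d L G` satisfying
`∫ f(U[e ↦ g U_e]) dμ = ∫ f(U) e^{-β (S(U[e ↦ g⁻¹ U_e]) - S(U))} dμ` for every edge `e`, every
`g ∈ G` and every continuous `f` is `wilsonMeasure ρ β` (converse of `haarShift_wilsonExpectation`;
`G` compact metrisable, `ρ` continuous). [folklore] -/
theorem eq_wilsonMeasure_of_haarShift [NeZero L] [Nonempty G] (hρ : Continuous ρ) (β : ℝ)
    {μ : Measure (GaugeConfig d L G)} [IsProbabilityMeasure μ]
    (h : ∀ (e : Edge d L) (g : G) (f : GaugeConfig d L G → ℝ), Continuous f →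
      ∫ U, f (Function.update U e (g * U e)) ∂μ =
        ∫ U, f U * Real.exp (-(β * (wilsonAction ρ (Function.update U e (g⁻¹ * U e)) -
          wilsonAction ρ U))) ∂μ) :
    μ = wilsonMeasure ρ β := by
  have hψ : Continuous fun U : GaugeConfig d L G => -β * wilsonAction ρ U := by
    refine continuous_const.mul ?_
    unfold wilsonAction
    refine continuous_finsetSum _ fun p _ => ?_
    have h1 : Continuous fun U : GaugeConfig d L G => plaquetteHolonomy U p.1 p.2.1.1 p.2.1.2 := by
      unfold plaquetteHolonomy; fun_prop
    exact continuous_const.sub (Complex.continuous_re.comp (hρ.comp h1).matrix_trace)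
  have hμ := eq_pi_tilted_of_haarShift (ι := Edge d L) (G := G) hψ (μ := μ) fun e g f hf => by
    rw [h e g f hf]
    refine integral_congr_ae (ae_of_all _ fun U => ?_)
    simp only [show ∀ a b : ℝ, -(β * (a - b)) = -β * a - -β * b from fun a b => by ring]
  rw [hμ, wilsonMeasure_eq_tilted_pi ρ hρ β]

end Torus

end Summit.QuantumFields.GaugeBoot
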